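import Summits.Ventures.YMGap.RobustBall.HeatBathPoincareZd
import Summits.Ventures.YMGap.RobustBall.LangevinPoincare
import Summits.Ventures.YMGap.RobustBall.VarianceTiltTools
import Summits.Ventures.YMGap.Thresholds.MassGapFromGradientPoincare
import Literature.Probability.LatticeModels.DobrushinMetricInfiniteRange
import Literature.Probability.LatticeModels.BoundaryLawFunctionalLevels
import HarnessLib

/-!
# Robust ball (Y2) — THE LANGEVIN (GRADIENT-FORM) POINCARÉ INEQUALITY OF EVERY FINITE VOLUME OF `ℤ^d` WITH BOUNDARY CONDITION, UNIFORMLY IN BOTH,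
# ON THE KANTOROVICH–RUBINSTEIN WINDOW — `UniformKernelPoincareGrad` beyond Bakry–Émery

HONEST FRAMING: venture file of the cell `pub-ymgap` (QuantumFields programme), track ROBUST-BALL, seat rb-p2 (g13); the `ℤ^d`-KERNEL companion of
`LangevinPoincare.lean` (tori).  LATTICE statements at STRONG COUPLING for the Wilson specification `γ_V(·|η) = ymSpecification χ_N (Nβ) V η` of `SU(N)`
lattice Yang–Mills on `ℤ^d` ('t Hooft coupling `β`), every finite link volume `V` and every boundary field `η`, with constants independent of `V` and `η`;
Wilson action only (class K); nothing about `β → ∞`, the continuum or Clay.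

THE STATEMENT (★★★ `kernel_variance_le_integral_Gam_of_oneLinkKRModulus`): `d ≥ 1`, `2(d−1)|β| ≤ R`, `OneLinkKRModulus N R K`, `c := 6(d−1)|β|K < 1`,
`K₀ := N/2 − N|β|·2(d−1) > 0`.  Then for EVERY finite `V`, EVERY `η` and every smooth `f` of the link matrices over `V`,
`Var_{γ_V(·|η)}(f) ≤ ((1 − c)K₀)⁻¹ ∫ Γ(f,f) dγ_V(·|η)` — in the venture's currency: ★★★ `uniformKernelPoincareGrad_of_oneLinkKRModulus :
UniformKernelPoincareGrad d N β ((1 − c)K₀)` (track (a)'s `MassGapFromGradientPoincare`: the Poincaré analogue of Stroock–Zegarlinski's uniform kernel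
log-Sobolev hypothesis; proved there by Bakry–Émery at `K = N/2 − 4dN|β|` on `|β| < 1/(8d)`).  ★★★ `su2_uniformKernelPoincareGrad`: `SU(2)`, `d = 4`, HYPOTHESIS-FREE
on `0 ≤ β_W < 2/9` ('t Hooft `β = β_W/4`): `UniformKernelPoincareGrad 4 2 (β_W/4) ((1 − 9β_W/2)(1 − 3β_W))` — the Bakry–Émery windows for this Prop are
`β_W < 1/12` (SZZ) and `β_W < 1/8` (venture `uniformKernelPoincareGrad_sharp`); ★★ `su2_uniformKernelPoincareGrad_dim3`: `d = 3`, `0 ≤ β_W < 1/3`,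
`UniformKernelPoincareGrad 3 2 (β_W/4) ((1 − 3β_W)(1 − 2β_W))` (Bakry–Émery: `β_W < 1/6`).  `uniformKernelPoincare_of_oneLinkKRModulus`: the Lipschitz form
(`UniformKernelPoincare`, via track (a)'s `uniformKernelPoincare_of_grad`).
MECHANISM: g12's kernel heat-bath Poincaré `HeatBathPoincareZd.kernelVariance_le_of_oneLinkKRModulus` (Glauber gap of `γ_V(·|η)`, uniform in `V`, `η`) ∘
properness (`siteAvg_eq_integral_siteLaw`: the one-link kernel resamples the link from `siteLaw`, in 't Hooft form `ν_{B_U}`, `siteLaw_ymSpecification_thooft`)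
∘ the fibre identity `integral_sq_sub_eq_sq_add_variance` ∘ the one-link Bakry–Émery step `LangevinPoincare.section_variance_le` for the section of `f`
(`‖B_U‖_op ≤ 2(d−1)|β|`) ∘ consistency `γ_V γ_{x} = γ_V` (`IsSpecification.integral_integral_eq_of_subset`) to integrate the block back.  0 sorry, 0 definitions.  «Spectral gap ≥ K» below is the standard READING of the Poincaré inequality with constant K⁻¹ for the Dirichlet
form ∫Γ (SZZ (1.6)); no generator / semigroup object is constructed in the tree.
References: H. Shen, R. Zhu, X. Zhu, CMP 400 (2023) 805–851, Cor. 4.4; D. Stroock, B. Zegarlinski, CMP 144 (1992) 303; L. Wu, Ann. Probab. 34 (2006) 1960.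
Everything here is proved. [folklore]
-/

noncomputable section

open scoped Matrix ComplexConjugate BigOperators Matrix.Norms.Frobenius ContDiff Topology ProbabilityTheory
open Matrix Complex Finset MeasureTheory Filter ProbabilityTheory Function Real
open Literature.Probability.LatticeModels Literature.Probability.LatticeModels.DobrushinMetric
open Literature.MathematicalPhysics.QuantumLattice hiding torusNorm
open Literature.MathematicalPhysics.QuantumFieldTheory hiding ZdEdge
open Summit.QuantumFields.YangMills.Theorems.StrongPinningPoincare
open Literature.MathematicalPhysics.QuantumFieldTheory.SUNBakryEmery (SUN FrameIdx frame haarSU pot)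
open Literature.MathematicalPhysics.QuantumFieldTheory.Balaban1983to89.StrongCouplingDobrushinWindow (OneLinkKRModulus)
open Summit.Ventures.YMGap.LatticeBakryEmery
open Summit.Ventures.YMGap.RobustBall.HeatBathPoincareZd (kernelVariance_le_of_oneLinkKRModulus)

namespace Summit.Ventures.YMGap.RobustBall.LangevinPoincare

/-! ### Two small tools -/

section Tools

/-- Restricting an updated configuration to the volume is updating the restriction. [folklore] -/
theorem restrict_update_eq {d N : ℕ} (V : Finset (ZdEdge d)) {x : ZdEdge d} (hx : x ∈ V) (U : LGConfig d (SUN N)) (s : SUN N) :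
    (fun e : ↥V => ((update U x s) e : Matrix (Fin N) (Fin N) ℂ)) =
      update (fun e : ↥V => (U e : Matrix (Fin N) (Fin N) ℂ)) ⟨x, hx⟩ (s : Matrix (Fin N) (Fin N) ℂ) := by
  funext e
  by_cases he : e = ⟨x, hx⟩
  · subst he; simp
  · have he' : (e : ZdEdge d) ≠ x := fun h => he (Subtype.ext h)
    rw [update_of_ne he, update_of_ne he']

end Tools

/-! ### The kernel Langevin Poincaré inequality -/

section Kernel

variable {d N : ℕ}

/-- ★★★ **THE LANGEVIN (GRADIENT-FORM) POINCARÉ INEQUALITY OF A FINITE VOLUME OF `ℤ^d` WITH BOUNDARY CONDITION, UNIFORMLY IN BOTH** (`SU(N)`, 't Hooft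
coupling `β`): if `2(d−1)|β| ≤ R`, `OneLinkKRModulus N R K`, `6(d−1)|β|K ≤ c < 1` and `K₀ := N/2 − N|β|·2(d−1) > 0`, then for every finite link volume `V`, every
boundary field `η` and every smooth `f` of the link matrices over `V`,
`Var_{γ_V(·|η)}(f) ≤ ((1 − c)K₀)⁻¹ ∫ Γ(f,f) dγ_V(·|η)` — the Langevin dynamics of `γ_V(·|η)` has spectral gap `≥ (1 − c)K₀`, uniformly in `V` and `η`. [folklore] -/
theorem kernel_variance_le_integral_Gam_of_oneLinkKRModulus (hd : 1 ≤ d) (hN : 1 ≤ N) {β R K c : ℝ} (hK : 0 ≤ K)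
    (hR : |β| * (2 * ((d : ℝ) - 1)) ≤ R) (hmod : OneLinkKRModulus N R K) (hc : 6 * ((d : ℝ) - 1) * |β| * K ≤ c) (hc1 : c < 1)
    (hK₀ : 0 < (N : ℝ) / 2 - N * |β| * (2 * ((d : ℝ) - 1)))
    (V : Finset (ZdEdge d)) (η : LGConfig d (SUN N)) {f : Cfg ↥V N → ℝ} (hf : ContDiff ℝ ∞ f) :
    Var[matrixCylinder V f; ymSpecification (fundamentalRep (Fin N)) ((N : ℝ) * β) V η] ≤
      ((1 - c) * ((N : ℝ) / 2 - N * |β| * (2 * ((d : ℝ) - 1))))⁻¹ *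
        ∫ U, Gam f f (fun e : ↥V => (U e : Matrix (Fin N) (Fin N) ℂ)) ∂(ymSpecification (fundamentalRep (Fin N)) ((N : ℝ) * β) V η) := by
  classical
  haveI : SecondCountableTopology (Matrix (Fin N) (Fin N) ℂ) := inferInstanceAs (SecondCountableTopology (Fin N → Fin N → ℂ))
  haveI : SecondCountableTopology (SUN N) := Topology.IsEmbedding.subtypeVal.secondCountableTopology
  have hN0 : N ≠ 0 := by omega
  have hNpos : (0 : ℝ) < N := by exact_mod_cast Nat.pos_of_ne_zero hN0
  have hρc := continuous_fundamentalRep (Fin N)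
  set K₀ : ℝ := (N : ℝ) / 2 - N * |β| * (2 * ((d : ℝ) - 1)) with hK₀def
  set γ := ymSpecification (d := d) (fundamentalRep (Fin N)) ((N : ℝ) * β) with hγdef
  have hγ : IsSpecification γ := isSpecification_ymSpecification_of_t2Space _ hρc _
  set μ : Measure (LGConfig d (SUN N)) := γ V η with hμdef
  haveI : IsProbabilityMeasure μ := hγ.isProbability V η
  have hc0 : 0 < 1 - c := by linarith
  -- the observable and the link blocks of `Γ`
  set cfgV : LGConfig d (SUN N) → Cfg ↥V N := fun U e => (U e : Matrix (Fin N) (Fin N) ℂ) with hcfgV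
  have hcfgc : Continuous cfgV := continuous_pi fun e => continuous_subtype_val.comp (continuous_apply _)
  set F : LGConfig d (SUN N) → ℝ := matrixCylinder V f with hFdef
  have hFeq : ∀ U, F U = f (cfgV U) := fun U => rfl
  have hFc : Continuous F := hf.continuous.comp hcfgc
  have hFm : Measurable F := hFc.measurable
  obtain ⟨M, hM⟩ := exists_bound_of_continuous hFc
  set blk : ZdEdge d → LGConfig d (SUN N) → ℝ := fun x U =>
    if hx : x ∈ V then ∑ α : FrameIdx N, algD (lk (⟨x, hx⟩ : ↥V) (frame α)) f (cfgV U) ^ 2 else 0 with hblk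
  have hblk_of_mem : ∀ {x} (hx : x ∈ V) (U : LGConfig d (SUN N)), blk x U = ∑ α : FrameIdx N, algD (lk (⟨x, hx⟩ : ↥V) (frame α)) f (cfgV U) ^ 2 :=
    fun hx U => by simp only [hblk, dif_pos hx]
  have hblkc : ∀ {x} (hx : x ∈ V), Continuous (blk x) := fun {x} hx => by
    have h : blk x = fun U => ∑ α : FrameIdx N, algD (lk (⟨x, hx⟩ : ↥V) (frame α)) f (cfgV U) ^ 2 := funext (hblk_of_mem hx)
    rw [h]
    exact continuous_finsetSum _ fun α _ => ((contDiff_algD hf _).continuous.comp hcfgc).pow 2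
  have hblk0 : ∀ x U, 0 ≤ blk x U := fun x U => by
    by_cases hx : x ∈ V
    · rw [hblk_of_mem hx]; exact Finset.sum_nonneg fun α _ => sq_nonneg _
    · simp only [hblk, dif_neg hx]; exact le_rfl
  -- the empty volume: the kernel is a point mass, the variance vanishes
  by_cases hVne : V = ∅
  · have hprop := hγ.proper V η
    have hconst : ∀ᵐ U ∂μ, F U = F η := by
      filter_upwards [hprop] with U hU
      have : U = η := funext fun z => hU z (by simp [hVne])
      rw [this]
    have hvar0 : Var[F; μ] = 0 := by
      rw [variance_eq_integral hFm.aemeasurable]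
      have hmean : ∫ U, F U ∂μ = F η := by
        rw [integral_congr_ae hconst]; simp
      have h2 : (fun U => (F U - ∫ U', F U' ∂μ) ^ 2) =ᵐ[μ] fun _ => (0 : ℝ) := by
        filter_upwards [hconst] with U hU
        rw [hU, hmean, sub_self]
        ring
      rw [integral_congr_ae h2]
      simp
    rw [hvar0]
    exact mul_nonneg (inv_nonneg.2 (mul_nonneg hc0.le hK₀.le)) (integral_nonneg fun U => Gam_self_nonneg f _)
  have hVne' : V.Nonempty := Finset.nonempty_iff_ne_empty.2 hVne
  -- (1) the heat-bath Poincaré inequality of the kernel (rb-p2 g12)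
  have hHB := kernelVariance_le_of_oneLinkKRModulus hd hN hK hR hmod hc hc1 hVne' η hFm ⟨M, hM⟩
  -- (2)+(3) PER LINK of the volume
  have key : ∀ x ∈ V, ∫ U, ∫ σ, (F U - F σ) ^ 2 ∂(γ {x} U) ∂μ ≤ 2 * K₀⁻¹ * ∫ U, blk x U ∂μ := by
    intro x hx
    -- names: the one-link law, the heat-bath mean, the conditional variance, the block average
    have hlaw : ∀ U, IsProbabilityMeasure (siteLaw γ x U) := fun U => isProbabilityMeasure_siteLaw hγ x U
    set m : LGConfig d (SUN N) → ℝ := siteAvg γ x F with hmdef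
    have hmm : Measurable m := measurable_siteAvg hγ x hFm
    have hmb : ∀ U, |m U| ≤ M := fun U => abs_siteAvg_le hγ x hM U
    have hm_eq : ∀ U, m U = ∫ s, F (update U x s) ∂(siteLaw γ x U) := fun U => siteAvg_eq_integral_siteLaw hγ x hFm U
    have hm_upd : ∀ U s, m (update U x s) = m U := fun U s => by
      rw [hm_eq, hm_eq, siteLaw_congr_of_eq_off' hγ x (fun z hz => update_of_ne hz _ _)]
      simp only [update_idem]
    -- the square deviation `h = (F − m)²`, bounded measurable
    have hh : Measurable fun U => (F U - m U) ^ 2 := (hFm.sub hmm).pow_const 2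
    have hhb : ∀ U, |(F U - m U) ^ 2| ≤ (2 * M) ^ 2 := fun U => by
      rw [abs_pow]
      refine pow_le_pow_left₀ (abs_nonneg _) ((abs_sub _ _).trans ?_) 2
      linarith [hM U, hmb U]
    obtain ⟨Mb, hMb⟩ := exists_bound_of_continuous (hblkc hx)
    -- pointwise in `U`: inner integral = bias² + conditional variance, and conditional variance ≤ K₀⁻¹ · block average
    have hpt : ∀ U, ∫ σ, (F U - F σ) ^ 2 ∂(γ {x} U) ≤ (F U - m U) ^ 2 + K₀⁻¹ * siteAvg γ x (blk x) U := by
      intro U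
      haveI := hlaw U
      have e1 : ∫ σ, (F U - F σ) ^ 2 ∂(γ {x} U) = ∫ s, (F U - F (update U x s)) ^ 2 ∂(siteLaw γ x U) :=
        siteAvg_eq_integral_siteLaw hγ x (f := fun σ => (F U - F σ) ^ 2) ((measurable_const.sub hFm).pow_const 2) U
      have hψm : Measurable fun s : SUN N => F (update U x s) := hFm.comp (measurable_update U)
      rw [e1, integral_sq_sub_eq_sq_add_variance (siteLaw γ x U) hψm (fun s => hM _) (F U), ← hm_eq U]
      refine add_le_add le_rfl ?_
      -- the one-link Bakry–Émery step in 't Hooft form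
      rw [siteAvg_eq_integral_siteLaw hγ x (hblkc hx).measurable U]
      simp_rw [hblk_of_mem hx, hFeq]
      simp_rw [show ∀ s : SUN N, cfgV (update U x s) = update (cfgV U) ⟨x, hx⟩ (s : Matrix (Fin N) (Fin N) ℂ) from
        fun s => restrict_update_eq V hx U s]
      rw [hm_eq U]
      simp_rw [hFeq, show ∀ s : SUN N, cfgV (update U x s) = update (cfgV U) ⟨x, hx⟩ (s : Matrix (Fin N) (Fin N) ℂ) from
        fun s => restrict_update_eq V hx U s]
      rw [hγdef, siteLaw_ymSpecification_thooft β x U]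
      set B := stapleField β x U with hBdef
      have hB : matrixOpNorm B ≤ |β| * (2 * ((d : ℝ) - 1)) := matrixOpNorm_stapleField_le hd hN β x U
      have hK1 : K₀ ≤ (N : ℝ) / 2 - N * matrixOpNorm B := by
        have : (N : ℝ) * matrixOpNorm B ≤ N * (|β| * (2 * ((d : ℝ) - 1))) := mul_le_mul_of_nonneg_left hB hNpos.le
        rw [hK₀def]; linarith
      have hK1pos : 0 < (N : ℝ) / 2 - N * matrixOpNorm B := lt_of_lt_of_le hK₀ hK1
      have hsec := section_variance_le hN0 hf (cfgV U) ⟨x, hx⟩ B hK1pos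
      set ν : Measure (SUN N) := (haarSU N).tilted fun g : SUN N => (N : ℝ) * ((g : Matrix (Fin N) (Fin N) ℂ) * B).trace.re with hν
      have hwc : Continuous fun g : SUN N => Real.exp (pot (N : ℝ) B g) :=
        Real.continuous_exp.comp (SUNBakryEmery.continuous_restrict (SUNBakryEmery.contDiff_pot _ B))
      haveI : IsProbabilityMeasure ν := isProbabilityMeasure_tilted (SUNBakryEmery.integrable_of_continuous_SUN hwc _)
      have hψc : Continuous fun g : SUN N => f (update (cfgV U) ⟨x, hx⟩ (g : Matrix (Fin N) (Fin N) ℂ)) :=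
        SUNBakryEmery.continuous_restrict (contDiff_section hf (cfgV U) ⟨x, hx⟩)
      have hvar : Var[fun g : SUN N => f (update (cfgV U) ⟨x, hx⟩ (g : Matrix (Fin N) (Fin N) ℂ)); ν] = ∫ g, (f (update (cfgV U) ⟨x, hx⟩
          (g : Matrix (Fin N) (Fin N) ℂ)) - ∫ g', f (update (cfgV U) ⟨x, hx⟩ (g' : Matrix (Fin N) (Fin N) ℂ)) ∂ν) ^ 2 ∂ν :=
        variance_eq_integral hψc.measurable.aemeasurable
      show ∫ g, (f (update (cfgV U) ⟨x, hx⟩ (g : Matrix (Fin N) (Fin N) ℂ)) - ∫ g', f (update (cfgV U) ⟨x, hx⟩ (g' : Matrix (Fin N) (Fin N) ℂ)) ∂ν) ^ 2 ∂ν ≤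
        K₀⁻¹ * ∫ g, ∑ α : FrameIdx N, algD (lk (⟨x, hx⟩ : ↥V) (frame α)) f (update (cfgV U) ⟨x, hx⟩ (g : Matrix (Fin N) (Fin N) ℂ)) ^ 2 ∂ν
      rw [← hvar, ← div_eq_inv_mul, le_div_iff₀ hK₀]
      calc Var[fun g : SUN N => f (update (cfgV U) ⟨x, hx⟩ (g : Matrix (Fin N) (Fin N) ℂ)); ν] * K₀
          ≤ Var[fun g : SUN N => f (update (cfgV U) ⟨x, hx⟩ (g : Matrix (Fin N) (Fin N) ℂ)); ν] * ((N : ℝ) / 2 - N * matrixOpNorm B) :=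
            mul_le_mul_of_nonneg_left hK1 (variance_nonneg _ _)
        _ ≤ _ := by rw [mul_comm]; exact hsec
    -- integrate over the kernel; consistency `γ_V γ_{x} = γ_V` twice
    have hxV : ({x} : Finset (ZdEdge d)) ⊆ V := Finset.singleton_subset_iff.2 hx
    have hI0 : Integrable (fun U => ∫ σ, (F U - F σ) ^ 2 ∂(γ {x} U)) μ :=
      HeatBath.integrable_of_abs_le (HeatBathPoincareZd.measurable_integral_sq_sub hγ x hFm hM)
        (fun U => HeatBathPoincareZd.abs_integral_sq_sub_le hγ x hM U)
    have hI1 : Integrable (fun U => (F U - m U) ^ 2) μ := HeatBath.integrable_of_abs_le hh hhb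
    have hI2 : Integrable (fun U => K₀⁻¹ * siteAvg γ x (blk x) U) μ :=
      (HeatBath.integrable_of_abs_le (measurable_siteAvg hγ x (hblkc hx).measurable) (fun U => abs_siteAvg_le hγ x hMb U)).const_mul _
    have hDLR1 : ∫ U, (F U - m U) ^ 2 ∂μ = ∫ U, siteAvg γ x (fun U' => (F U' - m U') ^ 2) U ∂μ :=
      (hγ.integral_integral_eq_of_subset hxV η (hI1 : Integrable (fun U => (F U - m U) ^ 2) (γ V η))).symm
    have hDLR1' : ∀ U, siteAvg γ x (fun U' => (F U' - m U') ^ 2) U ≤ K₀⁻¹ * siteAvg γ x (blk x) U := by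
      intro U
      haveI := hlaw U
      -- `T_x (F − m)² (U) = Var_{siteLaw}(ψ_U) ≤ K₀⁻¹ T_x blk (U)` : the bias term of `hpt` at the resampled configuration vanishes on average
      have e1 : siteAvg γ x (fun U' => (F U' - m U') ^ 2) U = ∫ s, (F (update U x s) - m U) ^ 2 ∂(siteLaw γ x U) := by
        rw [siteAvg_eq_integral_siteLaw hγ x hh U]
        simp only [hm_upd]
      have hψm : Measurable fun s : SUN N => F (update U x s) := hFm.comp (measurable_update U)
      have e2 : ∫ s, (F (update U x s) - m U) ^ 2 ∂(siteLaw γ x U) =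
          ∫ σ, (F U - F σ) ^ 2 ∂(γ {x} U) - (F U - m U) ^ 2 := by
        have e4 : ∫ σ, (F U - F σ) ^ 2 ∂(γ {x} U) = ∫ s, (F U - F (update U x s)) ^ 2 ∂(siteLaw γ x U) :=
          siteAvg_eq_integral_siteLaw hγ x (f := fun σ => (F U - F σ) ^ 2) ((measurable_const.sub hFm).pow_const 2) U
        rw [e4, integral_sq_sub_eq_sq_add_variance (siteLaw γ x U) hψm (fun s => hM _) (F U), ← hm_eq U]
        ring
      rw [e1, e2]
      linarith [hpt U]
    have hDLR2 : ∫ U, siteAvg γ x (blk x) U ∂μ = ∫ U, blk x U ∂μ :=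
      hγ.integral_integral_eq_of_subset hxV η (HeatBath.integrable_of_abs_le (hblkc hx).measurable hMb)
    have hstep1 : ∫ U, ∫ σ, (F U - F σ) ^ 2 ∂(γ {x} U) ∂μ ≤ ∫ U, (F U - m U) ^ 2 ∂μ + ∫ U, K₀⁻¹ * siteAvg γ x (blk x) U ∂μ := by
      rw [← integral_add hI1 hI2]
      exact integral_mono hI0 (hI1.add hI2) hpt
    have hstep2 : ∫ U, (F U - m U) ^ 2 ∂μ ≤ ∫ U, K₀⁻¹ * siteAvg γ x (blk x) U ∂μ := by
      rw [hDLR1]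
      exact integral_mono (HeatBath.integrable_of_abs_le (measurable_siteAvg hγ x hh) (fun U => abs_siteAvg_le hγ x hhb U)) hI2 hDLR1'
    rw [integral_const_mul, hDLR2] at hstep1 hstep2
    linarith
  -- SUM OVER THE VOLUME
  have hsum : ∑ x ∈ V, ∫ U, ∫ σ, (F U - F σ) ^ 2 ∂(γ {x} U) ∂μ ≤ 2 * K₀⁻¹ * ∫ U, Gam f f (cfgV U) ∂μ := by
    calc _ ≤ ∑ x ∈ V, 2 * K₀⁻¹ * ∫ U, blk x U ∂μ := Finset.sum_le_sum key
      _ = 2 * K₀⁻¹ * ∫ U, Gam f f (cfgV U) ∂μ := by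
          rw [← Finset.mul_sum, ← integral_finsetSum _ fun x hx =>
            HeatBath.integrable_of_abs_le (hblkc hx).measurable (Classical.choose_spec (exists_bound_of_continuous (hblkc hx)))]
          congr 1
          refine integral_congr_ae (ae_of_all _ fun U => ?_)
          show ∑ i ∈ V, blk i U = Gam f f (cfgV U)
          rw [Gam_eq_sum_blocks, ← Finset.sum_attach]
          exact Finset.sum_congr rfl fun i _ => hblk_of_mem i.2 U
  -- ASSEMBLY
  calc Var[F; μ] ≤ (2 * (1 - c))⁻¹ * ∑ x ∈ V, ∫ U, ∫ σ, (F U - F σ) ^ 2 ∂(γ {x} U) ∂μ := hHB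
    _ ≤ (2 * (1 - c))⁻¹ * (2 * K₀⁻¹ * ∫ U, Gam f f (cfgV U) ∂μ) := mul_le_mul_of_nonneg_left hsum (by positivity)
    _ = ((1 - c) * K₀)⁻¹ * ∫ U, Gam f f (cfgV U) ∂μ := by field_simp

/-- ★★★ **`UniformKernelPoincareGrad` ON THE KANTOROVICH–RUBINSTEIN WINDOW** (the venture's currency, `MassGapFromGradientPoincare`): under the hypotheses of
`kernel_variance_le_integral_Gam_of_oneLinkKRModulus`, `UniformKernelPoincareGrad d N β ((1 − c)K₀)` — the uniform kernel Poincaré inequality in the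
`linkGradSq` currency of the tree's kernel log-Sobolev fact, for every finite region and boundary condition. [folklore] -/
theorem uniformKernelPoincareGrad_of_oneLinkKRModulus (hd : 1 ≤ d) (hN : 1 ≤ N) {β R K c : ℝ} (hK : 0 ≤ K)
    (hR : |β| * (2 * ((d : ℝ) - 1)) ≤ R) (hmod : OneLinkKRModulus N R K) (hc : 6 * ((d : ℝ) - 1) * |β| * K ≤ c) (hc1 : c < 1)
    (hK₀ : 0 < (N : ℝ) / 2 - N * |β| * (2 * ((d : ℝ) - 1))) :
    UniformKernelPoincareGrad d N β ((1 - c) * ((N : ℝ) / 2 - N * |β| * (2 * ((d : ℝ) - 1)))) := by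
  intro E η f hf
  have h := kernel_variance_le_integral_Gam_of_oneLinkKRModulus hd hN hK hR hmod hc hc1 hK₀ E η hf
  rw [one_div]
  refine h.trans (le_of_eq ?_)
  congr 1
  have hpt : ∀ U : LGConfig d (SUN N), Gam f f (fun e : ↥E => (U e : Matrix (Fin N) (Fin N) ℂ)) =
      ∑ e : ↥E, linkGradSq E f e (fun e' => (U e' : Matrix (Fin N) (Fin N) ℂ)) :=
    fun U => Gam_eq_sum_linkGradSq (by omega) E hf (fun e : ↥E => U e)
  simp_rw [hpt]
  rw [integral_finsetSum]
  intro e _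
  haveI : IsProbabilityMeasure (ymSpecification (fundamentalRep (Fin N)) ((N : ℝ) * β) E η) :=
    (isSpecification_ymSpecification_of_t2Space _ (continuous_fundamentalRep (Fin N)) _).isProbability E η
  have hc' : Continuous fun U : LGConfig d (SUN N) => linkGradSq E f e (fun e' => (U e' : Matrix (Fin N) (Fin N) ℂ)) := by
    have h1 : ∀ U : LGConfig d (SUN N), linkGradSq E f e (fun e' => (U e' : Matrix (Fin N) (Fin N) ℂ)) =
        ∑ α : FrameIdx N, algD (lk e (frame α)) f (emb (fun e' : ↥E => U e')) ^ 2 := fun U => by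
      unfold linkGradSq
      rw [show (fun e' : ↥E => (U e' : Matrix (Fin N) (Fin N) ℂ)) = emb (fun e' : ↥E => U e') from rfl,
        sum_sq_deriv_update_eq (by omega) hf _ e (emb_mem_unitaryGroup _ e)]
    simp_rw [h1]
    refine continuous_finsetSum _ fun α _ => ?_
    refine ((contDiff_algD hf _).continuous.comp ?_).pow 2
    exact continuous_emb.comp (continuous_pi fun e' => continuous_apply _)
  exact HeatBath.integrable_of_abs_le hc'.measurable (Classical.choose_spec (exists_bound_of_continuous hc'))

/-- **The Lipschitz form** (`UniformKernelPoincare`, track (a)'s `uniformKernelPoincare_of_grad`): `Var_{γ_E(·|η)}(f) ≤ ((1 − c)K₀)⁻¹ ∑_e L_e²` for smooth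
per-link `L_e`-Lipschitz `f`, every finite region `E` and boundary field `η`. [folklore] -/
theorem uniformKernelPoincare_of_oneLinkKRModulus (hd : 1 ≤ d) (hN : 1 ≤ N) {β R K c : ℝ} (hK : 0 ≤ K)
    (hR : |β| * (2 * ((d : ℝ) - 1)) ≤ R) (hmod : OneLinkKRModulus N R K) (hc : 6 * ((d : ℝ) - 1) * |β| * K ≤ c) (hc1 : c < 1)
    (hK₀ : 0 < (N : ℝ) / 2 - N * |β| * (2 * ((d : ℝ) - 1))) :
    UniformKernelPoincare d N β ((1 - c) * ((N : ℝ) / 2 - N * |β| * (2 * ((d : ℝ) - 1)))) :=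
  uniformKernelPoincare_of_grad (by omega) (mul_pos (by linarith) hK₀)
    (uniformKernelPoincareGrad_of_oneLinkKRModulus hd hN hK hR hmod hc hc1 hK₀)

/-- ★★★ **`SU(2)`, `d = 4`, HYPOTHESIS-FREE: `UniformKernelPoincareGrad 4 2 (β_W/4) ((1 − 9β_W/2)(1 − 3β_W))` on `0 ≤ β_W < 2/9`** ('t Hooft `β = β_W/4`, bare
`β_W/2`; quarter modulus): the Langevin dynamics of EVERY finite volume of `ℤ⁴` with EVERY boundary field has spectral gap `≥ (1 − 9β_W/2)(1 − 3β_W)`.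
The Bakry–Émery windows for this Prop are `β_W < 1/12` (Shen–Zhu–Zhu) and `β_W < 1/8` (venture `uniformKernelPoincareGrad_sharp`, `1 − 8β_W`). [folklore] -/
theorem su2_uniformKernelPoincareGrad {βW : ℝ} (h0 : 0 ≤ βW) (h : βW < 2 / 9) :
    UniformKernelPoincareGrad 4 2 (βW / 4) ((1 - 9 * βW / 2) * (1 - 3 * βW)) := by
  have habs : |βW / 4| = βW / 4 := abs_of_nonneg (by positivity)
  have key := uniformKernelPoincareGrad_of_oneLinkKRModulus (d := 4) (N := 2) (by norm_num) (by norm_num) (β := βW / 4) zero_le_one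
    (R := 3 * βW / 2) (by rw [habs]; norm_num; linarith) (SlabAreaLawDimensions.su2_oneLinkKRModulus_of_le_one (by linarith))
    (c := 9 * βW / 2) (by rw [habs]; norm_num; linarith) (by linarith) (by rw [habs]; norm_num; linarith)
  have e : (1 - 9 * βW / 2) * (((2 : ℕ) : ℝ) / 2 - (2 : ℕ) * |βW / 4| * (2 * (((4 : ℕ) : ℝ) - 1))) = (1 - 9 * βW / 2) * (1 - 3 * βW) := by
    rw [habs]; push_cast; ring
  rw [e] at key
  exact key

/-- **`SU(2)`, `d = 4`, Lipschitz form**: `UniformKernelPoincare 4 2 (β_W/4) ((1 − 9β_W/2)(1 − 3β_W))` on `0 ≤ β_W < 2/9`. [folklore] -/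
theorem su2_uniformKernelPoincare {βW : ℝ} (h0 : 0 ≤ βW) (h : βW < 2 / 9) :
    UniformKernelPoincare 4 2 (βW / 4) ((1 - 9 * βW / 2) * (1 - 3 * βW)) :=
  uniformKernelPoincare_of_grad (by norm_num) (mul_pos (by linarith) (by linarith)) (su2_uniformKernelPoincareGrad h0 h)

/-- ★★ **`SU(2)`, `d = 3`, HYPOTHESIS-FREE: `UniformKernelPoincareGrad 3 2 (β_W/4) ((1 − 3β_W)(1 − 2β_W))` on `0 ≤ β_W < 1/3`** ('t Hooft `β = β_W/4`; quarter
modulus, `c = 3β_W`, `K₀ = 1 − 2β_W`): the Langevin dynamics of every finite volume of `ℤ³` with every boundary field has spectral gap `≥ (1 − 3β_W)(1 − 2β_W)`;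
the Bakry–Émery window for this Prop in `d = 3` is `β_W < 1/6` (venture `uniformKernelPoincareGrad_sharp`, 't Hooft `1/24`). [folklore] -/
theorem su2_uniformKernelPoincareGrad_dim3 {βW : ℝ} (h0 : 0 ≤ βW) (h : βW < 1 / 3) :
    UniformKernelPoincareGrad 3 2 (βW / 4) ((1 - 3 * βW) * (1 - 2 * βW)) := by
  have habs : |βW / 4| = βW / 4 := abs_of_nonneg (by positivity)
  have key := uniformKernelPoincareGrad_of_oneLinkKRModulus (d := 3) (N := 2) (by norm_num) (by norm_num) (β := βW / 4) zero_le_one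
    (R := βW) (by rw [habs]; norm_num) (SlabAreaLawDimensions.su2_oneLinkKRModulus_of_le_one (by linarith))
    (c := 3 * βW) (by rw [habs]; norm_num; linarith) (by linarith) (by rw [habs]; norm_num; linarith)
  have e : (1 - 3 * βW) * (((2 : ℕ) : ℝ) / 2 - (2 : ℕ) * |βW / 4| * (2 * (((3 : ℕ) : ℝ) - 1))) = (1 - 3 * βW) * (1 - 2 * βW) := by
    rw [habs]; push_cast; ring
  rw [e] at key
  exact key

end Kernel

end Summit.Ventures.YMGap.RobustBall.LangevinPoincare

end
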